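import Summits.QuantumFields.YangMills.Theorems.UnitScaleTiltProp7TwistedLevelMassInduction
import HarnessLib

/-!
# `UnitScaleTiltProp7FrameRem2Induction` — THE SECOND-ORDER FRAME-REMAINDER INDUCTION (pure real bookkeeping; R0-RECURSION file F-γ1):
# `Ψ₀ = 0`, `Ψ_{l+1} ≤ (L³)⁻¹·Ψ_l + (c_B·M_l + c_D·D_l + c_Φ·Φ_l)`, each source two-slot-bounded `X_l ≤ A_X·(Lˡ)⁻¹ + B_X·Lˡ`
# ⟹ **`Ψ_l ≤ 2L·(c_BA_M + c_DA_D + c_ΦA_Φ)·(Lˡ)⁻¹ + (c_BB_M + c_DB_D + c_ΦB_Φ)·Lˡ`** — the damped one-tower remainder masses DECAY LIKE THE SINGLE-BAR MASSES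
(route `UnitScaleTilt`, crux K1 «MinimiserStabilityRegPr» stmt-QuantumFields-19200; ★★OWNER RULING №19 (3)∕№20 «R0-RECURSION := px13 g6»; LOCATE `LOCATE-R0-RECURSION-px13g6.md` §1 (Ψ-IND);
the one-step inequality is ✓`Prop7FrameRem2Step.frameRem2_step_le` (F-α) with its stair letter from ✓`Prop7StairRem2Row` (F-β); this file is the induction, a corollary of ✓px22's
`Prop7TwistedLevelMassInduction.frameMass_induction` at `q := (L³)⁻¹`; def-free, count-neutral, pure reals).
Cell `ym3-torus` (HUMAN RULING D-0037, YM ladder rung R3 — YM₃ on T³ is a rung, not d = 4, not infinite volume, not a mass gap, not Clay), width seat `ym3-torus-px13` (gen 6).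

THE LETTERS (all real sequences indexed by the level): `Ψ_l` = the `ℓ¹` mass of the second-order remainders of the accumulated frames at level `l`; the three sources of F-α∕F-β —
`M_l` the single-bar level mass ((n3) ✓`Prop7FibreLevelMassPerLevelT3.sum_normSq_levelRatio_le_LOnly_T3`: `≤ 7M₀L^{−l} + (…)Lˡ`), `Φ_l` the accumulated-frame mass (✓`frameMass_induction`:
two-slot), `D_l` the plain tower's second-order single-bar remainder mass («(n3)₂-sym» ∕ `hMcomb₂`: DISPLAYED two-slot rows).  The damping `(L³)⁻¹` is F-α's free block-mean contraction at `d = 3`.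
WHAT IS PROVED (sorry-free): ★★ `frameRem2_induction` (the title) and `frameRem2_top_le` (the top instance, the form F-γ2 consumes).
HONEST FRAMING.  Pure reals; nothing of REM2ˢ∕(R0)∕(β)∕hPA2∕hcoS∕E′∕EX∕the crux is proved; rung R3, not Clay; YM gap NOT proved.  `--supports stmt-QuantumFields-19200 --as helper`.
References: T. Bałaban, CMP 98 (1985) 17–51 [Balaban1985Averaging] ((97) p.32, Prop. 3 (122)–(126) p.36); CMP 95 (1984) 17–40 [Balaban1984PropagatorsI] ((1.18)–(1.20) pp.19–20).
-/

set_option autoImplicit false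

noncomputable section

namespace Summit.QuantumFields.YangMills.Theorems.Prop7FrameRem2Induction

open Summit.QuantumFields.YangMills.Theorems.Prop7TwistedLevelMassInduction (frameMass_induction)

/-- ★★ **THE SECOND-ORDER FRAME-REMAINDER INDUCTION**: `Ψ₀ = 0`, `Ψ_{l+1} ≤ (L³)⁻¹Ψ_l + (c_B·M_l + c_D·D_l + c_Φ·Φ_l)` for `l < k`, and for `l ≤ k` the sources obey `M_l ≤ A_M(Lˡ)⁻¹ + B_MLˡ`,
`D_l ≤ A_D(Lˡ)⁻¹ + B_DLˡ`, `Φ_l ≤ A_Φ(Lˡ)⁻¹ + B_ΦLˡ` (`L ≥ 2`, all constants `≥ 0`) ⟹ `Ψ_l ≤ 2L·(c_BA_M + c_DA_D + c_ΦA_Φ)·(Lˡ)⁻¹ + (c_BB_M + c_DB_D + c_ΦB_Φ)·Lˡ` for every `l ≤ k`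
(✓`frameMass_induction` at `q := (L³)⁻¹`, `qL = L⁻² ≤ ½`, `C := 1`). [cite: Balaban1985Averaging, (97) p.32, Prop. 3 (122)-(126) p.36] -/
theorem frameRem2_induction {L cB cD cΦ AM BM AD BD AΦ BΦ : ℝ} (hL : 2 ≤ L)
    (hcB : 0 ≤ cB) (hcD : 0 ≤ cD) (hcΦ : 0 ≤ cΦ) (hAM : 0 ≤ AM) (hBM : 0 ≤ BM) (hAD : 0 ≤ AD) (hBD : 0 ≤ BD) (hAΦ : 0 ≤ AΦ) (hBΦ : 0 ≤ BΦ)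
    (k : ℕ) (Ψ M D Φ : ℕ → ℝ) (hΨ0 : Ψ 0 = 0)
    (hΨ : ∀ l < k, Ψ (l + 1) ≤ (L ^ 3)⁻¹ * Ψ l + (cB * M l + cD * D l + cΦ * Φ l))
    (hM : ∀ l ≤ k, M l ≤ AM * (L ^ l)⁻¹ + BM * L ^ l) (hD : ∀ l ≤ k, D l ≤ AD * (L ^ l)⁻¹ + BD * L ^ l)
    (hΦ : ∀ l ≤ k, Φ l ≤ AΦ * (L ^ l)⁻¹ + BΦ * L ^ l) :
    ∀ l ≤ k, Ψ l ≤ 2 * L * (cB * AM + cD * AD + cΦ * AΦ) * (L ^ l)⁻¹ + (cB * BM + cD * BD + cΦ * BΦ) * L ^ l := by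
  have hL0 : 0 < L := by linarith
  -- `q := (L³)⁻¹`, `qL ≤ ½`
  have hq : 0 ≤ (L ^ 3)⁻¹ := by positivity
  have hqL : (L ^ 3)⁻¹ * L ≤ 1 / 2 := by
    have hL3 : L ^ 3 = L ^ 2 * L := by ring
    rw [hL3, mul_inv, mul_assoc, inv_mul_cancel₀ hL0.ne', mul_one]
    have h4 : (4 : ℝ) ≤ L ^ 2 := by nlinarith
    calc (L ^ 2)⁻¹ ≤ (4 : ℝ)⁻¹ := inv_anti₀ (by norm_num) h4
      _ ≤ 1 / 2 := by norm_num
  -- the combined source `S_l := c_B M_l + c_D D_l + c_Φ Φ_l` is two-slot with `A := c_BA_M + c_DA_D + c_ΦA_Φ` (read as `A·M₀` with `M₀ := 1`), `B := c_BB_M + c_DB_D + c_ΦB_Φ`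
  have hS : ∀ l ≤ k, cB * M l + cD * D l + cΦ * Φ l ≤ (cB * AM + cD * AD + cΦ * AΦ) * 1 * (L ^ l)⁻¹ + (cB * BM + cD * BD + cΦ * BΦ) * L ^ l := by
    intro l hl
    have h1 := mul_le_mul_of_nonneg_left (hM l hl) hcB
    have h2 := mul_le_mul_of_nonneg_left (hD l hl) hcD
    have h3 := mul_le_mul_of_nonneg_left (hΦ l hl) hcΦ
    nlinarith [h1, h2, h3]
  have hΨ' : ∀ l < k, Ψ (l + 1) ≤ (L ^ 3)⁻¹ * Ψ l + 1 * (cB * M l + cD * D l + cΦ * Φ l) := fun l hl => by rw [one_mul]; exact hΨ l hl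
  have h := frameMass_induction (q := (L ^ 3)⁻¹) (C := 1) (A := cB * AM + cD * AD + cΦ * AΦ) (B := cB * BM + cD * BD + cΦ * BΦ) (M₀ := 1)
    hL hq hqL zero_le_one (by positivity) (by positivity) zero_le_one k Ψ (fun l => cB * M l + cD * D l + cΦ * Φ l) hΨ0 hΨ' hS
  intro l hl
  have := h l hl
  simpa [mul_one, one_mul, mul_assoc] using this

/-- ★★ **THE TOP INSTANCE** (the form the member knit consumes): under the same rows, `Ψ_k ≤ 2L·(c_BA_M + c_DA_D + c_ΦA_Φ)·(Lᵏ)⁻¹ + (c_BB_M + c_DB_D + c_ΦB_Φ)·Lᵏ` — with `Lᵏ = ℓ = L^{K−n}`,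
`A_M = 7M₀`-class and `B_M = (c·KD + c′ℓ⁻²M₀)`-class ((n3)), this is the E2E currency `C₁ℓ⁻¹M₀ + C₂ℓKD` up to the displayed `D` slots. [cite: Balaban1985Averaging, Prop. 3 (122)-(126) p.36] -/
theorem frameRem2_top_le {L cB cD cΦ AM BM AD BD AΦ BΦ : ℝ} (hL : 2 ≤ L)
    (hcB : 0 ≤ cB) (hcD : 0 ≤ cD) (hcΦ : 0 ≤ cΦ) (hAM : 0 ≤ AM) (hBM : 0 ≤ BM) (hAD : 0 ≤ AD) (hBD : 0 ≤ BD) (hAΦ : 0 ≤ AΦ) (hBΦ : 0 ≤ BΦ)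
    (k : ℕ) (Ψ M D Φ : ℕ → ℝ) (hΨ0 : Ψ 0 = 0)
    (hΨ : ∀ l < k, Ψ (l + 1) ≤ (L ^ 3)⁻¹ * Ψ l + (cB * M l + cD * D l + cΦ * Φ l))
    (hM : ∀ l ≤ k, M l ≤ AM * (L ^ l)⁻¹ + BM * L ^ l) (hD : ∀ l ≤ k, D l ≤ AD * (L ^ l)⁻¹ + BD * L ^ l)
    (hΦ : ∀ l ≤ k, Φ l ≤ AΦ * (L ^ l)⁻¹ + BΦ * L ^ l) :
    Ψ k ≤ 2 * L * (cB * AM + cD * AD + cΦ * AΦ) * (L ^ k)⁻¹ + (cB * BM + cD * BD + cΦ * BΦ) * L ^ k :=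
  frameRem2_induction hL hcB hcD hcΦ hAM hBM hAD hBD hAΦ hBΦ k Ψ M D Φ hΨ0 hΨ hM hD hΦ k le_rfl

end Summit.QuantumFields.YangMills.Theorems.Prop7FrameRem2Induction

end
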